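import Summits.QuantumFields.YangMills.Theses.SteinGapBootstrap
import Summits.QuantumFields.YangMills.Theorems.SteinGapBootstrapFreeProbeLawGStubBudgetRate
import Summits.QuantumFields.YangMills.Theorems.SteinGapBootstrapFreeProbeLawGStubFieldBounds
import Summits.QuantumFields.YangMills.Theorems.SteinGapBootstrapUSteinTransferPair
import Summits.QuantumFields.YangMills.Theorems.SteinGapBootstrapProbeCovFromPairLawG

/-! # Skeleton — line `birth` (Stein's seam) for crux U = `Theses.SteinGapBootstrap.FreeProbeLawG` (stmt-QuantumFields-23756)

Lead `ym-line-sgb-k1-g1` (2026-08-28). RESHAPE 2 of the planner's birth skeleton (ym-idea-4 g2): the XL child C1ᶠ `PairSteinDiscrepancyFreeG`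
(stmt-23798) is cut along the mechanism «closedness + block Green truncation + finite-β Schwinger–Dyson + energy budget» (NOTES.md §Mechanism
of the lead; no clustering, no conditional expectations):

* `stub_budgetRate` (M, LANDED p590174; imported): sharp equipartition at rate per plaquette for every torus-limit state, from the CLOSED
  `EntropyBudgetEquipartition.FreeEnergyRate` + `budgetRate_limitStates` + axis/orientation symmetry + B-TI.
* `stub_sdRate` (L): the tree's finite-β single-edge Schwinger–Dyson identity (TS5–TS7 of `EquipartitionPinsProbe`, `core_defect`,
  `defect_le`, `stub_haarShiftLimit`) generalised from trigonometric functions of ONE linear statistic to bounded `C¹` test functions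
  `g(Y_S)` of the block field, WITH EXPLICIT RATE: `|E_μ[∂_v g(Y_S)] − E_μ[g(Y_S)·(d^*Y)_e^b]| ≤ C(1+M)(1+ρS)^c β^(−κ)`, `v = dδ_e ⊗ e_b`,
  for limit states with plaquette energies `≤ E₀/β` (comb Poincaré `stub_combPoincare` gives the comb-link energies; `θ = β^(−1/2)`).
* `stub_blockGreen` (L, pure lattice analysis, no gauge theory): the truncated Green `1`-form `ω = 1_(box R) · Γ d^*δ_p`
  (`ω(e) = Σ_a σ_a edgeGreen (∂_a p) e`): supported in the box, `ℓ¹`-norm `≤ C(1+R)^c`, `dω = curvatureTwoPoint p ·` EXACTLY on plaquettes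
  well inside, and `|‖dω‖² − curvatureTwoPoint p p| ≤ C(1+R)^(−γ)` (tail/boundary layer from `latticeGreen_asymptotics`: `|ω(e)| ≲ |e|^(−3)`,
  `Σ_q Π(p,q)² = Π(p,p)`).
* `stub_fieldBounds` (M, LANDED p591633 by w3-g2; imported): (a) pointwise `Σ_a (Y_p^a)² ≤ 2β·cost_p` for the `(1,2)`-plaquettes on the `e₀` axis (comb gauge: one live link,
  Bessel for the orthonormal Lie frame, `‖V − 1‖²_HS = 2(N − Re tr V)`); (b) crude polynomial second moments `E_μ (Y_p^a)² ≤ C(1+|p|)^c` under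
  plaquette energies `≤ E₀/β` (comb Poincaré).
* `stub_assembly` (L, the lead's): (sdRate) → (blockGreen) → (fieldBounds) → [budget ⇒ C1ᶠ-conclusion]: Green resummation
  `E[⟨dω,Y⟩∂F] = Σ_e ω(e)·SD_e`, exact closedness of `Y = d(linkField)`, and the BACKGROUND LEMMA — the energy budget bounds
  `E|Y_p − ⟨dω,Y⟩|` through the characteristic-function ODE `φ_(Y_p)(t) = e^(−t²s/2) φ_X(t) + err` (trigonometric SD) and Gaussian deconvolution.
* `stub_steinTransfer : USteinTransferPair` (23799, CLOSED by `USteinTransferPair_proof`, w2) and `stub_probeFromPairLaw :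
  UProbeCovFromPairLaw` (23800, CLOSED by `uProbeCovFromPairLaw_proof`, w3) are now one-line citations.
OPEN sorries: `stub_sdRate`, `stub_blockGreen`, `stub_assembly`.
Compositions `stub_pairSteinOfBudget'` (assembly of the three inputs), `pairSteinDiscrepancyFreeG_of_budget` (⇒ C1ᶠ) and `FreeProbeLawG_of`
(⇒ the crux BY NAME; = CLOSED glue 23801) are kernel-checked below. Stub signatures avoid `let`/`letI` binders (gate registrar).
HONEST LABEL: the route closes the RECORD rung R2ξ-G (`WeakCouplingRates.XiPow`, an upper bound on the lattice gap) conditionally on U;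
nothing here proves the Yang–Mills mass gap. -/

open MeasureTheory

namespace Summit.QuantumFields.YangMills.Cruxes.FreeProbeLawG.SteinFree

open Summit.QuantumFields.YangMills.Theses.SteinGapBootstrap

/-- STUB `stub_sdRate` (L): quantitative multi-dimensional single-edge Schwinger–Dyson identity of torus-limit states for the rescaled
comb-gauge plaquette field — `E_μ[∂_v g(Y_S)] ≈ E_μ[g(Y_S)·Σ_p (dδ_e)_p Y_p^b]`, `v_(p,a) = (dδ_e)_p [a = b]`, error
`C(1+M)(1+ρS)^c β^(−κ)` for bounded `C¹` tests `g` with `‖∇g‖ ≤ M`, supports `S ⊇ plaquettesTouching {e}` of radius `ρS`, plaquette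
energies `≤ E₀/β`. -/
theorem stub_sdRate :
    ∀ (G : Type) [Group G] [TopologicalSpace G] [IsTopologicalGroup G] [CompactSpace G]
      [MeasurableSpace G] [BorelSpace G],
      Literature.MathematicalPhysics.QuantumFieldTheory.IsCompactSimpleLieGroup G →
      ∀ r : Literature.MathematicalPhysics.QuantumFieldTheory.LatticeRep G,
        ∀ E₀ : ℝ, ∃ Csd c κsd : ℝ, 0 < κsd ∧ 0 ≤ Csd ∧ ∀ β : ℝ, 1 ≤ β →
          ∀ μ ∈ Literature.MathematicalPhysics.QuantumLattice.infiniteVolumeLimitPoints (d := 4) r.ρ β,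
            (∀ (x : Literature.Probability.LatticeModels.Site 4) (i j : Fin 4), i ≠ j →
              β * (∫ U, ((r.N : ℝ) - Literature.MathematicalPhysics.QuantumLattice.plaquetteObs r.ρ x i j U) ∂μ) ≤ E₀) →
            ∀ (e : Literature.MathematicalPhysics.QuantumLattice.ZdEdge 4) (b : Fin (Summit.QuantumFields.YangMills.Theorems.EquipartitionPinsProbe.lieDim r)) (S : Finset (Literature.MathematicalPhysics.QuantumLattice.ZdPlaquette 4)) (ρS : ℕ),
              Literature.MathematicalPhysics.QuantumLattice.plaquettesTouching {e} ⊆ S → (∀ p ∈ S, ∀ k : Fin 4, |p.1 k| ≤ (ρS : ℤ)) →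
              ∀ (g : (↥S → Fin (Summit.QuantumFields.YangMills.Theorems.EquipartitionPinsProbe.lieDim r) → ℝ) → ℝ) (M : ℝ), 0 ≤ M → ContDiff ℝ 1 g →
                (∀ y, |g y| ≤ 1) → (∀ y, ‖fderiv ℝ g y‖ ≤ M) →
                |(∑ p : ↥S, Literature.MathematicalPhysics.QuantumFieldTheory.plaquetteCurl (fun e' => if e' = e then (1 : ℝ) else 0) (p : Literature.MathematicalPhysics.QuantumLattice.ZdPlaquette 4) *
                      ∫ U, fderiv ℝ g (fun q a => Summit.QuantumFields.YangMills.Theorems.EquipartitionPinsProbe.plaqField r β U (q : Literature.MathematicalPhysics.QuantumLattice.ZdPlaquette 4) a)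
                        (fun q a => if q = p ∧ a = b then (1 : ℝ) else 0) ∂μ) -
                    ∫ U, g (fun q a => Summit.QuantumFields.YangMills.Theorems.EquipartitionPinsProbe.plaqField r β U (q : Literature.MathematicalPhysics.QuantumLattice.ZdPlaquette 4) a) *
                      (∑ p ∈ S, Literature.MathematicalPhysics.QuantumFieldTheory.plaquetteCurl (fun e' => if e' = e then (1 : ℝ) else 0) p *
                        Summit.QuantumFields.YangMills.Theorems.EquipartitionPinsProbe.plaqField r β U p b) ∂μ| ≤
                  Csd * (1 + M) * (1 + (ρS : ℝ)) ^ c * β ^ (-κsd) := by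
  sorry

/-- STUB `stub_blockGreen` (L, pure lattice potential theory on `ℤ⁴`): the box-truncated Green `1`-form of a plaquette. -/
theorem stub_blockGreen :
    ∃ Cg c γ : ℝ, 0 < γ ∧ 0 ≤ Cg ∧ ∀ (p : Literature.MathematicalPhysics.QuantumLattice.ZdPlaquette 4) (R : ℕ), (∀ k : Fin 4, 2 * |p.1 k| + 2 ≤ (R : ℤ)) →
        ∃ ω : Literature.MathematicalPhysics.QuantumLattice.ZdEdge 4 → ℝ,
          (∀ e, ω e ≠ 0 → ∀ k : Fin 4, |e.1 k| ≤ (R : ℤ)) ∧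
          (∀ T : Finset (Literature.MathematicalPhysics.QuantumLattice.ZdEdge 4), ∑ e ∈ T, |ω e| ≤ Cg * (1 + (R : ℝ)) ^ c) ∧
          (∀ q : Literature.MathematicalPhysics.QuantumLattice.ZdPlaquette 4, (∀ k : Fin 4, 2 * |q.1 k| + 2 ≤ (R : ℤ)) →
            Literature.MathematicalPhysics.QuantumFieldTheory.plaquetteCurl ω q = Literature.MathematicalPhysics.QuantumFieldTheory.curvatureTwoPoint p q) ∧
          (∀ T : Finset (Literature.MathematicalPhysics.QuantumLattice.ZdPlaquette 4), (∀ q, Literature.MathematicalPhysics.QuantumFieldTheory.plaquetteCurl ω q ≠ 0 → q ∈ T) →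
            |(∑ q ∈ T, (Literature.MathematicalPhysics.QuantumFieldTheory.plaquetteCurl ω q) ^ 2) - Literature.MathematicalPhysics.QuantumFieldTheory.curvatureTwoPoint p p| ≤ Cg * (1 + (R : ℝ)) ^ (-γ)) := by
  sorry

/-- STUB `stub_assembly` (L, lead): Green resummation + exact closedness + background lemma: the three inputs and the budget give the
conclusion of C1ᶠ (the body of `stub_pairSteinOfBudget`). -/
theorem stub_assembly :
    ∀ (G : Type) [Group G] [TopologicalSpace G] [IsTopologicalGroup G] [CompactSpace G]
      [MeasurableSpace G] [BorelSpace G],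
      Literature.MathematicalPhysics.QuantumFieldTheory.IsCompactSimpleLieGroup G →
      ∀ r : Literature.MathematicalPhysics.QuantumFieldTheory.LatticeRep G,
        (∀ E₀ : ℝ, ∃ Csd c κsd : ℝ, 0 < κsd ∧ 0 ≤ Csd ∧ ∀ β : ℝ, 1 ≤ β →
           ∀ μ ∈ Literature.MathematicalPhysics.QuantumLattice.infiniteVolumeLimitPoints (d := 4) r.ρ β,
             (∀ (x : Literature.Probability.LatticeModels.Site 4) (i j : Fin 4), i ≠ j →
               β * (∫ U, ((r.N : ℝ) - Literature.MathematicalPhysics.QuantumLattice.plaquetteObs r.ρ x i j U) ∂μ) ≤ E₀) →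
             ∀ (e : Literature.MathematicalPhysics.QuantumLattice.ZdEdge 4) (b : Fin (Summit.QuantumFields.YangMills.Theorems.EquipartitionPinsProbe.lieDim r)) (S : Finset (Literature.MathematicalPhysics.QuantumLattice.ZdPlaquette 4)) (ρS : ℕ),
               Literature.MathematicalPhysics.QuantumLattice.plaquettesTouching {e} ⊆ S → (∀ p ∈ S, ∀ k : Fin 4, |p.1 k| ≤ (ρS : ℤ)) →
               ∀ (g : (↥S → Fin (Summit.QuantumFields.YangMills.Theorems.EquipartitionPinsProbe.lieDim r) → ℝ) → ℝ) (M : ℝ), 0 ≤ M → ContDiff ℝ 1 g →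
                 (∀ y, |g y| ≤ 1) → (∀ y, ‖fderiv ℝ g y‖ ≤ M) →
                 |(∑ p : ↥S, Literature.MathematicalPhysics.QuantumFieldTheory.plaquetteCurl (fun e' => if e' = e then (1 : ℝ) else 0) (p : Literature.MathematicalPhysics.QuantumLattice.ZdPlaquette 4) *
                       ∫ U, fderiv ℝ g (fun q a => Summit.QuantumFields.YangMills.Theorems.EquipartitionPinsProbe.plaqField r β U (q : Literature.MathematicalPhysics.QuantumLattice.ZdPlaquette 4) a)
                         (fun q a => if q = p ∧ a = b then (1 : ℝ) else 0) ∂μ) -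
                     ∫ U, g (fun q a => Summit.QuantumFields.YangMills.Theorems.EquipartitionPinsProbe.plaqField r β U (q : Literature.MathematicalPhysics.QuantumLattice.ZdPlaquette 4) a) *
                       (∑ p ∈ S, Literature.MathematicalPhysics.QuantumFieldTheory.plaquetteCurl (fun e' => if e' = e then (1 : ℝ) else 0) p *
                         Summit.QuantumFields.YangMills.Theorems.EquipartitionPinsProbe.plaqField r β U p b) ∂μ| ≤
                   Csd * (1 + M) * (1 + (ρS : ℝ)) ^ c * β ^ (-κsd)) →
        (∃ Cg c γ : ℝ, 0 < γ ∧ 0 ≤ Cg ∧ ∀ (p : Literature.MathematicalPhysics.QuantumLattice.ZdPlaquette 4) (R : ℕ), (∀ k : Fin 4, 2 * |p.1 k| + 2 ≤ (R : ℤ)) →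
        ∃ ω : Literature.MathematicalPhysics.QuantumLattice.ZdEdge 4 → ℝ,
          (∀ e, ω e ≠ 0 → ∀ k : Fin 4, |e.1 k| ≤ (R : ℤ)) ∧
          (∀ T : Finset (Literature.MathematicalPhysics.QuantumLattice.ZdEdge 4), ∑ e ∈ T, |ω e| ≤ Cg * (1 + (R : ℝ)) ^ c) ∧
          (∀ q : Literature.MathematicalPhysics.QuantumLattice.ZdPlaquette 4, (∀ k : Fin 4, 2 * |q.1 k| + 2 ≤ (R : ℤ)) →
            Literature.MathematicalPhysics.QuantumFieldTheory.plaquetteCurl ω q = Literature.MathematicalPhysics.QuantumFieldTheory.curvatureTwoPoint p q) ∧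
          (∀ T : Finset (Literature.MathematicalPhysics.QuantumLattice.ZdPlaquette 4), (∀ q, Literature.MathematicalPhysics.QuantumFieldTheory.plaquetteCurl ω q ≠ 0 → q ∈ T) →
            |(∑ q ∈ T, (Literature.MathematicalPhysics.QuantumFieldTheory.plaquetteCurl ω q) ^ 2) - Literature.MathematicalPhysics.QuantumFieldTheory.curvatureTwoPoint p p| ≤ Cg * (1 + (R : ℝ)) ^ (-γ))) →
        ((∀ β : ℝ, 0 < β → ∀ (x : Literature.Probability.LatticeModels.Site 4), (∀ k : Fin 4, k ≠ 0 → x k = 0) →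
          ∀ U : Literature.MathematicalPhysics.QuantumLattice.LGConfig 4 G,
            ∑ a : Fin (Summit.QuantumFields.YangMills.Theorems.EquipartitionPinsProbe.lieDim r), (Summit.QuantumFields.YangMills.Theorems.EquipartitionPinsProbe.plaqField r β U (Literature.MathematicalPhysics.QuantumFieldTheory.plaquette12 (d := 4) (by norm_num) x) a) ^ 2 ≤
              2 * β * ((r.N : ℝ) - Literature.MathematicalPhysics.QuantumLattice.plaquetteObs r.ρ x 1 2 U)) ∧
        (∀ E₀ : ℝ, ∃ Cm c : ℝ, 0 ≤ Cm ∧ ∀ β : ℝ, 1 ≤ β →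
          ∀ μ ∈ Literature.MathematicalPhysics.QuantumLattice.infiniteVolumeLimitPoints (d := 4) r.ρ β,
            (∀ (x : Literature.Probability.LatticeModels.Site 4) (i j : Fin 4), i ≠ j →
              β * (∫ U, ((r.N : ℝ) - Literature.MathematicalPhysics.QuantumLattice.plaquetteObs r.ρ x i j U) ∂μ) ≤ E₀) →
            ∀ (p : Literature.MathematicalPhysics.QuantumLattice.ZdPlaquette 4) (a : Fin (Summit.QuantumFields.YangMills.Theorems.EquipartitionPinsProbe.lieDim r)),
              MeasureTheory.Integrable (fun U => (Summit.QuantumFields.YangMills.Theorems.EquipartitionPinsProbe.plaqField r β U p a) ^ 2) μ ∧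
              ∫ U, (Summit.QuantumFields.YangMills.Theorems.EquipartitionPinsProbe.plaqField r β U p a) ^ 2 ∂μ ≤ Cm * (1 + ∑ k : Fin 4, (|p.1 k| : ℝ)) ^ c)) →
        ∀ κ Cb : ℝ, 0 < κ →
        ∃ (K δ C β₀ : ℝ), 0 < δ ∧ 0 < C ∧ ∀ β : ℝ, β₀ ≤ β →
          ∀ μ ∈ Literature.MathematicalPhysics.QuantumLattice.infiniteVolumeLimitPoints (d := 4) r.ρ β,
            (∀ (x : Literature.Probability.LatticeModels.Site 4) (i j : Fin 4), i ≠ j →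
              |β * (∫ U, ((r.N : ℝ) - Literature.MathematicalPhysics.QuantumLattice.plaquetteObs r.ρ x i j U) ∂μ) -
                  (Summit.QuantumFields.YangMills.Theorems.EquipartitionPinsProbe.lieDim r : ℝ) / 4| ≤ Cb * β ^ (-κ)) →
            ∀ n : ℕ, 1 ≤ n → ∀ B : Finset (Literature.MathematicalPhysics.QuantumLattice.ZdPlaquette 4),
              B = {Literature.MathematicalPhysics.QuantumFieldTheory.plaquette12 (d := 4) (by norm_num) 0,
                    Literature.MathematicalPhysics.QuantumFieldTheory.plaquette12 (d := 4) (by norm_num) (Pi.single (0 : Fin 4) (n : ℤ))} →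
              ∀ (F : (↥B → Fin (Summit.QuantumFields.YangMills.Theorems.EquipartitionPinsProbe.lieDim r) → ℝ) → ℝ) (M : ℝ),
                0 ≤ M → ContDiff ℝ 2 F → (∀ x, ‖fderiv ℝ F x‖ ≤ 1) → (∀ x y, ‖fderiv ℝ F x - fderiv ℝ F y‖ ≤ M * ‖x - y‖) →
                |∫ U, Literature.MathematicalPhysics.QuantumFieldTheory.latticeMaxwellBlockGenerator B
                    (Summit.QuantumFields.YangMills.Theorems.EquipartitionPinsProbe.lieDim r) F
                    (fun p a => Summit.QuantumFields.YangMills.Theorems.EquipartitionPinsProbe.plaqField r β U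
                      (p : Literature.MathematicalPhysics.QuantumLattice.ZdPlaquette 4) a) ∂μ| ≤
                  C * (1 + (n : ℝ)) ^ K * β ^ (-δ) * (1 + M) := by
  sorry

/-- stub `stub_steinTransfer` — CLOSED: item 23799 proved by `USteinTransferPair_proof` (width seat w2-g2). -/
theorem stub_steinTransfer : USteinTransferPair :=
  Summit.QuantumFields.YangMills.Theorems.SteinGapBootstrap.USteinTransferPair_proof

/-- stub `stub_probeFromPairLaw` — CLOSED: item 23800 proved by `uProbeCovFromPairLaw_proof` (width seat w3-g2). -/
theorem stub_probeFromPairLaw : UProbeCovFromPairLaw :=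
  Summit.QuantumFields.YangMills.Theorems.SteinGapBootstrap.uProbeCovFromPairLaw_proof

/-- composition 0 (kernel-checked): the wall «Stein discrepancy from the budget» from the three inputs and the assembly. -/
theorem stub_pairSteinOfBudget' :
    ∀ (G : Type) [Group G] [TopologicalSpace G] [IsTopologicalGroup G] [CompactSpace G]
      [MeasurableSpace G] [BorelSpace G],
      Literature.MathematicalPhysics.QuantumFieldTheory.IsCompactSimpleLieGroup G →
      ∀ r : Literature.MathematicalPhysics.QuantumFieldTheory.LatticeRep G,
        ∀ κ Cb : ℝ, 0 < κ →
        ∃ (K δ C β₀ : ℝ), 0 < δ ∧ 0 < C ∧ ∀ β : ℝ, β₀ ≤ β →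
          ∀ μ ∈ Literature.MathematicalPhysics.QuantumLattice.infiniteVolumeLimitPoints (d := 4) r.ρ β,
            (∀ (x : Literature.Probability.LatticeModels.Site 4) (i j : Fin 4), i ≠ j →
              |β * (∫ U, ((r.N : ℝ) - Literature.MathematicalPhysics.QuantumLattice.plaquetteObs r.ρ x i j U) ∂μ) -
                  (Summit.QuantumFields.YangMills.Theorems.EquipartitionPinsProbe.lieDim r : ℝ) / 4| ≤ Cb * β ^ (-κ)) →
            ∀ n : ℕ, 1 ≤ n → ∀ B : Finset (Literature.MathematicalPhysics.QuantumLattice.ZdPlaquette 4),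
              B = {Literature.MathematicalPhysics.QuantumFieldTheory.plaquette12 (d := 4) (by norm_num) 0,
                    Literature.MathematicalPhysics.QuantumFieldTheory.plaquette12 (d := 4) (by norm_num) (Pi.single (0 : Fin 4) (n : ℤ))} →
              ∀ (F : (↥B → Fin (Summit.QuantumFields.YangMills.Theorems.EquipartitionPinsProbe.lieDim r) → ℝ) → ℝ) (M : ℝ),
                0 ≤ M → ContDiff ℝ 2 F → (∀ x, ‖fderiv ℝ F x‖ ≤ 1) → (∀ x y, ‖fderiv ℝ F x - fderiv ℝ F y‖ ≤ M * ‖x - y‖) →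
                |∫ U, Literature.MathematicalPhysics.QuantumFieldTheory.latticeMaxwellBlockGenerator B
                    (Summit.QuantumFields.YangMills.Theorems.EquipartitionPinsProbe.lieDim r) F
                    (fun p a => Summit.QuantumFields.YangMills.Theorems.EquipartitionPinsProbe.plaqField r β U
                      (p : Literature.MathematicalPhysics.QuantumLattice.ZdPlaquette 4) a) ∂μ| ≤
                  C * (1 + (n : ℝ)) ^ K * β ^ (-δ) * (1 + M) :=
  fun G _ _ _ _ _ _ hG r => stub_assembly G hG r (stub_sdRate G hG r) stub_blockGreen (stub_fieldBounds G hG r)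

/-- composition 1 (kernel-checked): budget rate + Stein-from-budget ⇒ C1ᶠ `PairSteinDiscrepancyFreeG` (the equipartition hypothesis (i)
of C1ᶠ is not needed: the budget stub supplies the sharp version for every limit state). -/
theorem pairSteinDiscrepancyFreeG_of_budget
    (hB : ∀ (G : Type) [Group G] [TopologicalSpace G] [IsTopologicalGroup G] [CompactSpace G]
        [MeasurableSpace G] [BorelSpace G],
        Literature.MathematicalPhysics.QuantumFieldTheory.IsCompactSimpleLieGroup G →
        ∀ r : Literature.MathematicalPhysics.QuantumFieldTheory.LatticeRep G,
        ∃ κ C β₀ : ℝ, 0 < κ ∧ ∀ β : ℝ, β₀ ≤ β →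
          ∀ μ ∈ Literature.MathematicalPhysics.QuantumLattice.infiniteVolumeLimitPoints (d := 4) r.ρ β,
            ∀ (x : Literature.Probability.LatticeModels.Site 4) (i j : Fin 4), i ≠ j →
              |β * (∫ U, ((r.N : ℝ) - Literature.MathematicalPhysics.QuantumLattice.plaquetteObs r.ρ x i j U) ∂μ) -
                  (Summit.QuantumFields.YangMills.Theorems.EquipartitionPinsProbe.lieDim r : ℝ) / 4| ≤ C * β ^ (-κ))
    (hS : ∀ (G : Type) [Group G] [TopologicalSpace G] [IsTopologicalGroup G] [CompactSpace G]
        [MeasurableSpace G] [BorelSpace G],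
        Literature.MathematicalPhysics.QuantumFieldTheory.IsCompactSimpleLieGroup G →
        ∀ r : Literature.MathematicalPhysics.QuantumFieldTheory.LatticeRep G,
        ∀ κ Cb : ℝ, 0 < κ →
        ∃ (K δ C β₀ : ℝ), 0 < δ ∧ 0 < C ∧ ∀ β : ℝ, β₀ ≤ β →
          ∀ μ ∈ Literature.MathematicalPhysics.QuantumLattice.infiniteVolumeLimitPoints (d := 4) r.ρ β,
            (∀ (x : Literature.Probability.LatticeModels.Site 4) (i j : Fin 4), i ≠ j →
              |β * (∫ U, ((r.N : ℝ) - Literature.MathematicalPhysics.QuantumLattice.plaquetteObs r.ρ x i j U) ∂μ) -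
                  (Summit.QuantumFields.YangMills.Theorems.EquipartitionPinsProbe.lieDim r : ℝ) / 4| ≤ Cb * β ^ (-κ)) →
            ∀ n : ℕ, 1 ≤ n → ∀ B : Finset (Literature.MathematicalPhysics.QuantumLattice.ZdPlaquette 4),
              B = {Literature.MathematicalPhysics.QuantumFieldTheory.plaquette12 (d := 4) (by norm_num) 0,
                    Literature.MathematicalPhysics.QuantumFieldTheory.plaquette12 (d := 4) (by norm_num) (Pi.single (0 : Fin 4) (n : ℤ))} →
              ∀ (F : (↥B → Fin (Summit.QuantumFields.YangMills.Theorems.EquipartitionPinsProbe.lieDim r) → ℝ) → ℝ) (M : ℝ),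
                0 ≤ M → ContDiff ℝ 2 F → (∀ x, ‖fderiv ℝ F x‖ ≤ 1) → (∀ x y, ‖fderiv ℝ F x - fderiv ℝ F y‖ ≤ M * ‖x - y‖) →
                |∫ U, Literature.MathematicalPhysics.QuantumFieldTheory.latticeMaxwellBlockGenerator B
                    (Summit.QuantumFields.YangMills.Theorems.EquipartitionPinsProbe.lieDim r) F
                    (fun p a => Summit.QuantumFields.YangMills.Theorems.EquipartitionPinsProbe.plaqField r β U
                      (p : Literature.MathematicalPhysics.QuantumLattice.ZdPlaquette 4) a) ∂μ| ≤
                  C * (1 + (n : ℝ)) ^ K * β ^ (-δ) * (1 + M)) :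
    PairSteinDiscrepancyFreeG := by
  intro G _ _ _ _ hG
  letI : MeasurableSpace G := borel G
  haveI : BorelSpace G := ⟨rfl⟩
  intro r C₀
  obtain ⟨κ, Cb, β₁, hκ, HB⟩ := hB G hG r
  obtain ⟨K, δ, C, β₀, hδ, hC, HS⟩ := hS G hG r κ Cb hκ
  refine ⟨K, δ, C, max β₀ β₁, hδ, hC, ?_⟩
  intro β hβ μ hμ _hi n hn B YB F M hM hF hF1 hF2
  exact HS β (le_trans (le_max_left _ _) hβ) μ hμ (HB β (le_trans (le_max_right _ _) hβ) μ hμ) n hn B rfl F M hM hF hF1 hF2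

/-- C1ᶠ from the stubs. -/
theorem stub_pairSteinFree' : PairSteinDiscrepancyFreeG :=
  pairSteinDiscrepancyFreeG_of_budget stub_budgetRate stub_pairSteinOfBudget'

theorem freeProbeLawG_of_split (h1 : PairSteinDiscrepancyFreeG) (h2 : SteinTransferPairG) (h3 : ProbeCovFromPairLawG) :
    FreeProbeLawG := by
  intro G _ _ _ _ hG r C₀
  obtain ⟨K, δ, C, β₀, hδ, hC, H1⟩ := h1 G hG r C₀
  obtain ⟨δ', C', β₀', hδ', hC', H3⟩ := h3 G hG r C₀
  refine ⟨max K 0, min δ δ', 2 * C * C' + C', max (max β₀ β₀') 1, lt_min hδ hδ', by positivity, ?_⟩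
  intro β hβ μ hμ hi hii n hn
  have hβ₀ : β₀ ≤ β := le_trans (le_trans (le_max_left _ _) (le_max_left _ _)) hβ
  have hβ₀' : β₀' ≤ β := le_trans (le_trans (le_max_right _ _) (le_max_left _ _)) hβ
  have hβ1 : 1 ≤ β := le_trans (le_max_right _ _) hβ
  have hβpos : 0 < β := lt_of_lt_of_le one_pos hβ1
  have H1' := H1 β hβ₀ μ hμ hi n hn
  set x : ℝ := 1 + (n : ℝ) with hx
  have hx1 : 1 ≤ x := by
    have : (0 : ℝ) ≤ (n : ℝ) := by positivity
    rw [hx]; linarith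
  have hxpos : 0 < x := lt_of_lt_of_le one_pos hx1
  set ε : ℝ := C * x ^ K * β ^ (-δ) with hε
  have hxK : 0 < x ^ K := Real.rpow_pos_of_pos hxpos K
  have hbδ : 0 < β ^ (-δ) := Real.rpow_pos_of_pos hβpos _
  have hε0 : 0 ≤ ε := by rw [hε]; positivity
  have H2' := h2 G hG r β μ hμ n hn ε hε0 (by
    intro F M hM hF hF1 hF2
    have := H1' F M hM hF hF1 hF2
    simpa [hε, mul_comm, mul_left_comm, mul_assoc] using this)
  have H3' := H3 β hβ₀' μ hμ hi n hn (2 * ε) (by positivity) H2'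
  refine le_trans H3' ?_
  have hxK' : x ^ K ≤ x ^ (max K 0) := Real.rpow_le_rpow_of_exponent_le hx1 (le_max_left _ _)
  have hx1K : 1 ≤ x ^ (max K 0) := Real.one_le_rpow hx1 (le_max_right _ _)
  have hb1 : β ^ (-δ) ≤ β ^ (-(min δ δ')) :=
    Real.rpow_le_rpow_of_exponent_le hβ1 (neg_le_neg (min_le_left _ _))
  have hb2 : β ^ (-δ') ≤ β ^ (-(min δ δ')) :=
    Real.rpow_le_rpow_of_exponent_le hβ1 (neg_le_neg (min_le_right _ _))
  have hbm : 0 < β ^ (-(min δ δ')) := Real.rpow_pos_of_pos hβpos _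
  have hbδ' : 0 < β ^ (-δ') := Real.rpow_pos_of_pos hβpos _
  have hxK0 : 0 < x ^ (max K 0) := Real.rpow_pos_of_pos hxpos _
  have step1 : C' * (2 * ε) ≤ 2 * C * C' * (x ^ (max K 0) * β ^ (-(min δ δ'))) := by
    rw [hε]
    have hle : x ^ K * β ^ (-δ) ≤ x ^ (max K 0) * β ^ (-(min δ δ')) :=
      mul_le_mul hxK' hb1 (le_of_lt hbδ) (le_of_lt hxK0)
    have h2cc : 0 ≤ 2 * C * C' := by positivity
    calc C' * (2 * (C * x ^ K * β ^ (-δ))) = 2 * C * C' * (x ^ K * β ^ (-δ)) := by ring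
      _ ≤ 2 * C * C' * (x ^ (max K 0) * β ^ (-(min δ δ'))) := mul_le_mul_of_nonneg_left hle h2cc
  have step2 : C' * β ^ (-δ') ≤ C' * (x ^ (max K 0) * β ^ (-(min δ δ'))) := by
    have : β ^ (-δ') ≤ x ^ (max K 0) * β ^ (-(min δ δ')) := by
      calc β ^ (-δ') ≤ β ^ (-(min δ δ')) := hb2
        _ = 1 * β ^ (-(min δ δ')) := (one_mul _).symm
        _ ≤ x ^ (max K 0) * β ^ (-(min δ δ')) := mul_le_mul_of_nonneg_right hx1K (le_of_lt hbm)
    exact mul_le_mul_of_nonneg_left this (le_of_lt hC')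
  calc C' * (2 * ε) + C' * β ^ (-δ')
      ≤ 2 * C * C' * (x ^ (max K 0) * β ^ (-(min δ δ'))) + C' * (x ^ (max K 0) * β ^ (-(min δ δ'))) :=
        add_le_add step1 step2
    _ = (2 * C * C' + C') * x ^ (max K 0) * β ^ (-(min δ δ')) := by ring

/-- composition 2 (kernel-checked): the four stubs give the crux BY NAME (aliases unfold by defeq). -/
theorem FreeProbeLawG_of :
    PairSteinDiscrepancyFreeG → USteinTransferPair → UProbeCovFromPairLaw →
      Summit.QuantumFields.YangMills.Theses.SteinGapBootstrap.FreeProbeLawG :=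
  fun h1 h2 h3 => freeProbeLawG_of_split h1 h2 h3

theorem FreeProbeLawG_holds : Summit.QuantumFields.YangMills.Theses.SteinGapBootstrap.FreeProbeLawG :=
  FreeProbeLawG_of stub_pairSteinFree' stub_steinTransfer stub_probeFromPairLaw

end Summit.QuantumFields.YangMills.Cruxes.FreeProbeLawG.SteinFree
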